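import Literature.MathematicalPhysics.QuantumFieldTheory.QCDTransferMatrix
import Summits.QuantumFields.QCD.Theorems.QuarksAsStableActionStableActionBridgeTransferPositivity
import Summits.QuantumFields.QCD.Theorems.QuarksAsStableActionStableActionBridgeGaugeKernelBounds
import Summits.QuantumFields.QCD.Theorems.QuarksAsStableActionStableActionBridgeFermionSliceContinuous
import Summits.QuantumFields.QCD.Theorems.QuarksAsStableActionStableActionBridgeCoreFermionStep
import Summits.QuantumFields.QCD.Theorems.QuarksAsStableActionStableActionBridgeCoreGaugeStep
import Summits.QuantumFields.QCD.Theorems.QuarksAsStableActionStableActionBridgeSliceGaugeUnitarity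
import Literature.MathematicalPhysics.QuantumFieldTheory.ConstructiveQFTWave0Proofs
import Mathlib.MeasureTheory.Integral.Prod
import Mathlib.MeasureTheory.Function.L2Space
import Mathlib.MeasureTheory.SpecificCodomains.Pi

/-!
# The scalar transfer operator maps the embedded form core into itself
(crux `HeatSlicedQuarks.RobustYangMillsHandover`, item stmt-QuantumFields-8892, line `pin-the-infimum`;
registered sub-goal `transferOp_apply_embed` of the spectral infrastructure M2)

Smit (*Introduction to Quantum Fields on a Lattice*, §6.5 (6.87)) writes the transfer matrix of
lattice QCD with `r = 1` Wilson quarks as `T̂ = T̂_F^{1/2} T̂_U T̂_F^{1/2}`.  The lead realises it as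
a scalar integral operator `T` on `L²(ν)`, `ν = sliceHaar S ⊗ count` on `SU(3)^{Edge 3 S} × J`
(`J ≃ Finset (SliceFermiIdx Nf S)` an enumeration of the occupation basis of the quark Fock space),
with kernel `k((U,s),(U',t)) = K_β(U,U') · (R(U) R(U'))_{st}`, where `K_β = gaugeSliceKernel β` is
the Wilson gauge kernel and `R(U)` is a continuous, Hermitian, gauge-covariant square root of the
fermionic transfer operator `T̂_F(U) = fermionSliceOp U mq` (all hypotheses; nothing is
constructed here).  Wave functions `Ψ` of the form core are embedded as
`f_Ψ(U, j) = (R(U) Ψ(U))_{e⁻¹ j}`.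

This file proves that `T` maps embedded core vectors to embedded core vectors: with
`Ψ'(U) = ∫ K_β(U,U') • (T̂_F(U') Ψ(U')) dU'`,

* `Ψ'` is continuous (parametric Bochner integral of a jointly continuous integrand over the
  compact slice, `CoreGaugeStep.continuous_integral_sliceHaar`);
* `Ψ'` is gauge invariant when `Ψ` is (`T̂_F` preserves the Gauss law by the covariance
  `T̂_F(U^g) = Γ(G_g) T̂_F(U) Γ(G_g)ᴴ`, `fermionSliceOp_gaugeTransform_mulVec`, and the Gauss-projected
  gauge transfer map preserves the core, `gaugeKernel_integral_mem_transferCore`);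
* `T f_Ψ = f_{Ψ'}` `ν`-a.e.: by Fubini over `ν = sliceHaar ⊗ count` (`integral_prod`,
  `integral_count`), `Σ_t K (R(U)R(U'))_{st} (R(U')Ψ(U'))_t = (R(U) (K • R(U')²Ψ(U')))_s
  = (R(U) (K • T̂_F(U')Ψ(U')))_s`, and the constant matrix `R(U)` commutes with the Bochner
  integral (`CoreGaugeStep.integral_mulVec_comm`).

References: J. Smit, *Introduction to Quantum Fields on a Lattice* (2023), §6.5 (6.87) and §4.6
(4.121)–(4.137) [Smit2023]; M. Lüscher, Commun. Math. Phys. 54 (1977) 283 [Luscher1977].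
Pure theorem file (no definitions).
-/

noncomputable section

namespace Summit.QuantumFields.QCD.Cruxes.RobustYangMillsHandover.PinTheInfimum

open MeasureTheory Matrix Literature.MathematicalPhysics.QuantumFieldTheory
  Literature.MathematicalPhysics.QuantumLattice
open Literature.Probability.LatticeModels (TorusSite)
open Summit.QuantumFields.QCD.Cruxes.StableActionBridge.Sketch

namespace TransferOpEmbed

variable {Nf S : ℕ} [NeZero S]

/-- The fermionic step `U ↦ T̂_F(U) Ψ(U) = R(U)² Ψ(U)` of a continuous wave function is continuous
whenever `T̂_F = R²` with `R` continuous (no mass hypothesis is needed in this form). [folklore] -/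
theorem continuous_fermionStep (mq : Fin Nf → ℝ)
    {R : GaugeConfig 3 S (Matrix.specialUnitaryGroup (Fin 3) ℂ) →
      Matrix (Finset (SliceFermiIdx Nf S)) (Finset (SliceFermiIdx Nf S)) ℂ}
    (hR : Continuous R) (hRR : ∀ U, R U * R U = fermionSliceOp U mq) {Ψ : SliceWave Nf S}
    (hΨ : Continuous Ψ) :
    Continuous fun U : GaugeConfig 3 S (Matrix.specialUnitaryGroup (Fin 3) ℂ) =>
      fermionSliceOp U mq *ᵥ Ψ U := by
  have h : (fun U : GaugeConfig 3 S (Matrix.specialUnitaryGroup (Fin 3) ℂ) =>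
      fermionSliceOp U mq *ᵥ Ψ U) = fun U => (R U * R U) *ᵥ Ψ U := by
    funext U
    rw [hRR U]
  rw [h]
  exact (hR.matrix_mul hR).matrix_mulVec hΨ

/-- The fermionic step preserves the Gauss law: if `Ψ(U^g) = Γ(G_g) Ψ(U)` then
`T̂_F(U^g) Ψ(U^g) = Γ(G_g) (T̂_F(U) Ψ(U))` (covariance of `T̂_F` and unitarity of `Γ(G_g)`,
`fermionSliceOp_gaugeTransform_mulVec`). [cite: Smit2023, §4.6 (4.127) and §6.5 (6.87)] -/
theorem isGaugeInvariantWave_fermionStep (mq : Fin Nf → ℝ) {Ψ : SliceWave Nf S}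
    (hΨ : IsGaugeInvariantWave Ψ) :
    IsGaugeInvariantWave (Nf := Nf) (S := S)
      fun U : GaugeConfig 3 S (Matrix.specialUnitaryGroup (Fin 3) ℂ) =>
        fermionSliceOp U mq *ᵥ Ψ U := by
  intro g U
  show fermionSliceOp (gaugeTransform g U) mq *ᵥ Ψ (gaugeTransform g U) =
    fockGaugeAct g *ᵥ (fermionSliceOp U mq *ᵥ Ψ U)
  rw [hΨ g U, fermionSliceOp_gaugeTransform_mulVec]

/-- The Fock-index sum of the scalar kernel against an embedded vector:
`Σ_t K (A B)_{st} (B v)_t = (A (K • (B² v)))_s`. [folklore] -/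
theorem fibre_sum {n : Type} [Fintype n] (K : ℂ) (A B : Matrix n n ℂ) (v : n → ℂ) (s : n) :
    ∑ t, K * (A * B) s t * (B *ᵥ v) t = (A *ᵥ (K • ((B * B) *ᵥ v))) s := by
  calc ∑ t, K * (A * B) s t * (B *ᵥ v) t = K * ((A * B) *ᵥ (B *ᵥ v)) s := by
        change ∑ t, K * (A * B) s t * (B *ᵥ v) t = K * ∑ t, (A * B) s t * (B *ᵥ v) t
        rw [Finset.mul_sum]
        simp only [mul_assoc]
    _ = (A *ᵥ (K • ((B * B) *ᵥ v))) s := by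
        rw [Matrix.mulVec_smul, Pi.smul_apply, smul_eq_mul, ← Matrix.mulVec_mulVec,
          ← Matrix.mulVec_mulVec]

/-- **The fibre integral of the scalar transfer kernel against an embedded core vector**: for every
background `U` and Fock index `s`,
`∫ K_β(U,U') (R(U)R(U'))_{s,e⁻¹j} (R(U')Ψ(U'))_{e⁻¹j} d(sliceHaar ⊗ count)(U',j)
  = (R(U) ∫ K_β(U,U') • T̂_F(U')Ψ(U') dU')_s`
(Fubini, the finite Fock sum, `R(U')² = T̂_F(U')`, and `R(U)` pulled out of the Bochner integral).
[cite: Smit2023, §6.5 (6.87)] -/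
theorem fibre_integral (β : ℝ) (mq : Fin Nf → ℝ) (J : Type) [Fintype J] [MeasurableSpace J]
    [MeasurableSingletonClass J] (e : Finset (SliceFermiIdx Nf S) ≃ J)
    {R : GaugeConfig 3 S (Matrix.specialUnitaryGroup (Fin 3) ℂ) →
      Matrix (Finset (SliceFermiIdx Nf S)) (Finset (SliceFermiIdx Nf S)) ℂ}
    (hR : Continuous R) (hRR : ∀ U, R U * R U = fermionSliceOp U mq) {Ψ : SliceWave Nf S}
    (hΨ : Continuous Ψ) (U : GaugeConfig 3 S (Matrix.specialUnitaryGroup (Fin 3) ℂ))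
    (s : Finset (SliceFermiIdx Nf S)) :
    ∫ q, (gaugeSliceKernel β U q.1 : ℂ) * (R U * R q.1) s (e.symm q.2) *
        (R q.1 *ᵥ Ψ q.1) (e.symm q.2) ∂((sliceHaar S).prod (Measure.count : Measure J)) =
      (R U *ᵥ ∫ U', (gaugeSliceKernel β U U' : ℂ) • (fermionSliceOp U' mq *ᵥ Ψ U')
        ∂(sliceHaar S)) s := by
  haveI := isProbabilityMeasure_sliceHaar S
  -- the kernel section `U' ↦ K_β(U, U')` is continuous
  have hKu : Continuous (Function.uncurry (gaugeSliceKernel (S := S) β)) :=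
    continuous_gaugeSliceKernel S β
  have hK : Continuous fun U' : GaugeConfig 3 S (Matrix.specialUnitaryGroup (Fin 3) ℂ) =>
      ((gaugeSliceKernel β U U' : ℝ) : ℂ) :=
    Complex.continuous_ofReal.comp (hKu.uncurry_left U)
  -- the Fock-vector-valued integrand before summation over the Fock index
  have hG : Continuous fun U' : GaugeConfig 3 S (Matrix.specialUnitaryGroup (Fin 3) ℂ) =>
      fun t : Finset (SliceFermiIdx Nf S) =>
        ((gaugeSliceKernel β U U' : ℝ) : ℂ) * (R U * R U') s t * (R U' *ᵥ Ψ U') t :=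
    continuous_pi fun t =>
      (hK.mul ((continuous_const.matrix_mul hR).matrix_elem s t)).mul
        ((continuous_apply t).comp (hR.matrix_mulVec hΨ))
  obtain ⟨C, hC⟩ := exists_bound_of_continuous_slice hG
  -- integrability on `sliceHaar ⊗ count`
  have hint : Integrable (fun q : GaugeConfig 3 S (Matrix.specialUnitaryGroup (Fin 3) ℂ) × J =>
      ((gaugeSliceKernel β U q.1 : ℝ) : ℂ) * (R U * R q.1) s (e.symm q.2) *
        (R q.1 *ᵥ Ψ q.1) (e.symm q.2)) ((sliceHaar S).prod (Measure.count : Measure J)) := by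
    refine (integrable_const C).mono' ?_ (Filter.Eventually.of_forall fun q => ?_)
    · refine (measurable_from_prod_countable_left fun j => ?_).aestronglyMeasurable
      exact ((continuous_apply (e.symm j)).comp hG).measurable
    · exact (norm_le_pi_norm (f := fun t : Finset (SliceFermiIdx Nf S) =>
        ((gaugeSliceKernel β U q.1 : ℝ) : ℂ) * (R U * R q.1) s t * (R q.1 *ᵥ Ψ q.1) t)
          (e.symm q.2)).trans (hC q.1)
  rw [integral_prod _ hint]
  simp only [integral_count]
  -- the Fock sum, reindexed along `e`
  have hsum : ∀ U' : GaugeConfig 3 S (Matrix.specialUnitaryGroup (Fin 3) ℂ),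
      ∑ j : J, ((gaugeSliceKernel β U U' : ℝ) : ℂ) * (R U * R U') s (e.symm j) *
          (R U' *ᵥ Ψ U') (e.symm j) =
        (R U *ᵥ (((gaugeSliceKernel β U U' : ℝ) : ℂ) • (fermionSliceOp U' mq *ᵥ Ψ U'))) s := by
    intro U'
    rw [Equiv.sum_comp e.symm (fun t => ((gaugeSliceKernel β U U' : ℝ) : ℂ) * (R U * R U') s t *
      (R U' *ᵥ Ψ U') t), fibre_sum, hRR U']
  simp_rw [hsum]
  -- pull the evaluation at `s` and the constant matrix `R U` out of the Bochner integral
  have hH : Continuous fun U' : GaugeConfig 3 S (Matrix.specialUnitaryGroup (Fin 3) ℂ) =>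
      ((gaugeSliceKernel β U U' : ℝ) : ℂ) • (fermionSliceOp U' mq *ᵥ Ψ U') :=
    hK.smul (continuous_fermionStep mq hR hRR hΨ)
  have hRH : Continuous fun U' : GaugeConfig 3 S (Matrix.specialUnitaryGroup (Fin 3) ℂ) =>
      R U *ᵥ (((gaugeSliceKernel β U U' : ℝ) : ℂ) • (fermionSliceOp U' mq *ᵥ Ψ U')) :=
    continuous_const.matrix_mulVec hH
  rw [← CoreGaugeStep.integral_mulVec_comm (R U)
    (CoreGaugeStep.integrable_sliceHaar_of_continuous' hH)]
  exact (eval_integral (μ := sliceHaar S)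
    (f := fun U' : GaugeConfig 3 S (Matrix.specialUnitaryGroup (Fin 3) ℂ) =>
      R U *ᵥ (((gaugeSliceKernel β U U' : ℝ) : ℂ) • (fermionSliceOp U' mq *ᵥ Ψ U')))
    (fun t => integrable_sliceHaar_of_continuous ((continuous_apply t).comp hRH)) s).symm

end TransferOpEmbed

open TransferOpEmbed

/-- **Registered sub-goal `transferOp_apply_embed` (line `pin-the-infimum`): the scalar transfer
operator maps the embedded form core into itself.**  Let `R(U)` be a continuous square root of
`T̂_F(U)` (`R(U)² = fermionSliceOp U mq`; the Hermitian and covariance hypotheses are part of the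
registered interface but not used here), `e` an enumeration of the Fock basis, and `T` any bounded
operator on `L²(sliceHaar ⊗ count)` given a.e. by the kernel
`k((U,s),(U',t)) = K_β(U,U') (R(U)R(U'))_{st}`.  For a continuous wave function `Ψ` put
`Ψ'(U) = ∫ K_β(U,U') • T̂_F(U')Ψ(U') dU'`.  Then `Ψ'` is continuous; `Ψ'` is gauge invariant if
`Ψ` is; and for every `f_Ψ ∈ L²` with `f_Ψ(U,j) = (R(U)Ψ(U))_{e⁻¹j}` a.e. one has
`(T f_Ψ)(U,j) = (R(U) Ψ'(U))_{e⁻¹j}` a.e. — Smit's `T̂ = T̂_F^{1/2} T̂_U T̂_F^{1/2}` acting on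
`T̂_F^{1/2}Ψ`. [cite: Smit2023, §6.5 (6.87)] -/
theorem transferOp_apply_embed : ∀ (Nf S : ℕ) [NeZero S] (β : ℝ) (mq : Fin Nf → ℝ) (J : Type) [Fintype J] [MeasurableSpace J] [MeasurableSingletonClass J] (e : Finset (SliceFermiIdx Nf S) ≃ J) (R : GaugeConfig 3 S (Matrix.specialUnitaryGroup (Fin 3) ℂ) → Matrix (Finset (SliceFermiIdx Nf S)) (Finset (SliceFermiIdx Nf S)) ℂ), Continuous R → (∀ U, (R U)ᴴ = R U) → (∀ U, R U * R U = fermionSliceOp U mq) → (∀ (g : TorusSite 3 S → Matrix.specialUnitaryGroup (Fin 3) ℂ) (U : GaugeConfig 3 S (Matrix.specialUnitaryGroup (Fin 3) ℂ)), R (gaugeTransform g U) = fockGaugeAct g * R U * (fockGaugeAct g)ᴴ) → ∀ Ψ : SliceWave Nf S, Continuous Ψ → (Continuous fun U : GaugeConfig 3 S (Matrix.specialUnitaryGroup (Fin 3) ℂ) => ∫ U', (gaugeSliceKernel β U U' : ℂ) • (fermionSliceOp U' mq *ᵥ Ψ U') ∂(sliceHaar S)) ∧ (IsGaugeInvariantWave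 Ψ → IsGaugeInvariantWave (Nf := Nf) (S := S) fun U => ∫ U', (gaugeSliceKernel β U U' : ℂ) • (fermionSliceOp U' mq *ᵥ Ψ U') ∂(sliceHaar S)) ∧ ∀ (fΨ : Lp ℂ 2 ((sliceHaar S).prod (Measure.count : Measure J))), ((fΨ : GaugeConfig 3 S (Matrix.specialUnitaryGroup (Fin 3) ℂ) × J → ℂ) =ᵐ[(sliceHaar S).prod (Measure.count : Measure J)] fun p => (R p.1 *ᵥ Ψ p.1) (e.symm p.2)) → ∀ T : Lp ℂ 2 ((sliceHaar S).prod (Measure.count : Measure J)) →L[ℂ] Lp ℂ 2 ((sliceHaar S).prod (Measure.count : Measure J)), (∀ φ : Lp ℂ 2 ((sliceHaar S).prod (Measure.count : Measure J)), (T φ : GaugeConfig 3 S (Matrix.specialUnitaryGroup (Fin 3) ℂ) × J → ℂ) =ᵐ[(sliceHaar S).prod (Measure.count : Measure J)] fun p => ∫ q, (gaugeSliceKernel β p.1 q.1 : ℂ) * (R p.1 * R q.1) (e.symm p.2) (e.symm q.2) * φ q ∂((sliceHaar S).prod (Measure.count : Measure J))) → (T fΨ : GaugeConfig 3 S (Matrix.specialUnitaryGroup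 (Fin 3) ℂ) × J → ℂ) =ᵐ[(sliceHaar S).prod (Measure.count : Measure J)] fun p => (R p.1 *ᵥ ∫ U', (gaugeSliceKernel β p.1 U' : ℂ) • (fermionSliceOp U' mq *ᵥ Ψ U') ∂(sliceHaar S)) (e.symm p.2) := by
  intro Nf S _ β mq J _ _ _ e R hR _ hRR _ Ψ hΨ
  -- the fermionic step `χ = T̂_F Ψ` is continuous, and the integrand `K_β(U,U') • χ(U')` jointly so
  have hχ : Continuous fun U' : GaugeConfig 3 S (Matrix.specialUnitaryGroup (Fin 3) ℂ) =>
      fermionSliceOp U' mq *ᵥ Ψ U' :=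
    continuous_fermionStep mq hR hRR hΨ
  have hF : Continuous (Function.uncurry
      fun (U U' : GaugeConfig 3 S (Matrix.specialUnitaryGroup (Fin 3) ℂ)) =>
        ((gaugeSliceKernel β U U' : ℝ) : ℂ) • (fermionSliceOp U' mq *ᵥ Ψ U')) :=
    (Complex.continuous_ofReal.comp (continuous_gaugeSliceKernel S β)).smul (hχ.comp continuous_snd)
  refine ⟨CoreGaugeStep.continuous_integral_sliceHaar hF, fun hinv => ?_, fun fΨ hfΨ T hT => ?_⟩
  · -- gauge invariance: the Gauss-projected gauge transfer map preserves the core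
    exact (gaugeKernel_integral_mem_transferCore Nf S β _
      ⟨hχ, isGaugeInvariantWave_fermionStep mq hinv⟩).2
  · -- the action on the embedded vector, fibre by fibre
    refine (hT fΨ).trans (Filter.Eventually.of_forall fun p => ?_)
    have hae : (fun q : GaugeConfig 3 S (Matrix.specialUnitaryGroup (Fin 3) ℂ) × J =>
        (gaugeSliceKernel β p.1 q.1 : ℂ) * (R p.1 * R q.1) (e.symm p.2) (e.symm q.2) *
          (fΨ : GaugeConfig 3 S (Matrix.specialUnitaryGroup (Fin 3) ℂ) × J → ℂ) q)
        =ᵐ[(sliceHaar S).prod (Measure.count : Measure J)] fun q =>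
          (gaugeSliceKernel β p.1 q.1 : ℂ) * (R p.1 * R q.1) (e.symm p.2) (e.symm q.2) *
            (R q.1 *ᵥ Ψ q.1) (e.symm q.2) :=
      hfΨ.mono fun q hq => by
        dsimp only
        rw [hq]
    dsimp only
    rw [integral_congr_ae hae]
    exact fibre_integral β mq J e hR hRR hΨ p.1 (e.symm p.2)

end Summit.QuantumFields.QCD.Cruxes.RobustYangMillsHandover.PinTheInfimum

end
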